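import Summits.Ventures.QEC.Thresholds.ToricCodePhenomenologicalCluster
import Summits.Ventures.QEC.Thresholds.ToricCodeExponentialDecay
import HarnessLib

/-!
# Exponential decay of the failure probability of the toric memory experiment below threshold
# (phenomenological model, `q = p`)

Venture QEC, `Summits/Ventures/QEC/Thresholds/` (LADDER-QEC Q5; the phenomenological twin of
`ToricCodeExponentialDecay.lean`). DKLP: "below threshold, the failure probability decreases
exponentially with `L`" (§5.3, after eq. (fail_iso) — stated there precisely for the 3D/noisy case,
"with `T` increasing no faster than a polynomial of `L`"). Two theorems, for every polynomially
bounded schedule of rounds and every minimum-weight space-time decoder family: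
* `phenom_decaysExponentially_cluster` — UNCONDITIONAL (kernel): `DecaysExponentially` at every
  `0 ≤ p < 1/(4·10⁴)`, from the cluster-route finite-size bound `3L²T r^L/(100(1-r))`
  (`ToricCodePhenomenologicalCluster.lean`) and the generic "polynomial × geometric" lemma
  `decaysExponentially_of_eventually_abs_le`;
* `phenom_decaysExponentially_sawCountBound3` — CONDITIONAL on the finite-size named fact
  `ToricCode.phenomFailureProb_le_of_sawCountBound` (DKLP eq. (fail_iso) shape): `DecaysExponentially`
  at every `0 ≤ p < p₀(ν)` under `cₙ(ℤ³) ≤ C νⁿ`.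
No decay RATE is certified beyond "some `r < 1`". No Monte Carlo number here.

## References

* [DennisEtAl2002] Dennis–Kitaev–Landahl–Preskill, J. Math. Phys. 43 (2002) 4452, §5.3 eq. (fail_iso)
  and the sentence after it.
* [Gottesman2014] D. Gottesman, Quantum Inf. Comput. 14 (2014) 1338, §4 Thm. 4.
-/

noncomputable section

namespace Summit.Ventures.QEC.Thresholds

open Filter Topology Finset
open Literature.InformationTheory.QuantumCodes
open Literature.InformationTheory.QuantumCodes.ToricCode
open Literature.Probability.RandomPlanarGeometry

namespace PhenomCluster

/-- **Exponential decay below `1/(4·10⁴)`, unconditional**: for every polynomially bounded schedule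
`T(L) ≤ A(L+1)^k` and every minimum-weight space-time decoder family, the failure probability of the
`T(L)`-round memory experiment (`q = p`) is `≤ C' r'^L` for some `C'` and `r' < 1`, at every
`0 ≤ p < 1/40000` (bound `3A(L+1)^{k+2} r^{L+1}/(100(1-r))`, `r = 200√p`). tier CERTIFIED (kernel).
[cite: DennisEtAl2002, §5.3 (after eq. (fail_iso): decreases exponentially with L, T polynomial in L)] -/
theorem phenom_decaysExponentially_cluster {T : ℕ → ℕ} (hT : IsPolyBounded T)
    {D : (L : ℕ) → STDecoder (L + 1) (T L)}
    (hD : ∀ L, (D L).IsMinWeight (stSyn (L + 1) (T L)) (stCycles (L + 1) (T L)) hammingNorm)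
    {p : ℝ} (hp₀ : 0 ≤ p) (hpp : p < 1 / (4 * (10 : ℝ) ^ 4)) :
    DecaysExponentially (phenomFailureFamily T D) p := by
  have hp₁ : p ≤ 1 := by
    have : 1 / (4 * (10 : ℝ) ^ 4) ≤ 1 := by norm_num
    linarith
  have hr1 : 2 * (10 : ℝ) ^ 2 * Real.sqrt p < 1 := by
    have := two_mul_sq_mul_sqrt_lt_one (Δ := 10) (by norm_num) (p := p) (by exact_mod_cast hpp)
    exact_mod_cast this
  set r : ℝ := 2 * (10 : ℝ) ^ 2 * Real.sqrt p with hr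
  have hr0 : 0 ≤ r := by positivity
  have h1r : 0 < 1 - r := by linarith
  obtain ⟨A, k, hA⟩ := hT
  refine decaysExponentially_of_eventually_abs_le (A := 3 * A * r / ((10 : ℝ) ^ 2 * (1 - r)))
    (k := k + 2) hr0 hr1 (Filter.Eventually.of_forall fun L => ?_)
  have hnonneg : 0 ≤ phenomFailureFamily T D L p := by
    simp only [phenomFailureFamily, phenomFailureProb]
    exact Finset.sum_nonneg fun E _ => by
      rw [phenomenologicalWeight_self]
      exact bernoulliWeight_nonneg hp₀ hp₁ _
  rw [abs_of_nonneg hnonneg]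
  have hb := phenomFailureProb_le_cluster (L + 1) (T L) (by omega) (hD L) hp₀ hp₁ hr1
  simp only [phenomFailureFamily]
  refine hb.trans ?_
  push_cast
  have hTL : (T L : ℝ) ≤ A * ((L : ℝ) + 1) ^ k := hA L
  have hden : 0 < (10 : ℝ) ^ 2 * (1 - r) := by positivity
  rw [div_mul_eq_mul_div, div_mul_eq_mul_div, div_le_div_iff_of_pos_right hden, pow_succ]
  have hnum : 3 * ((L : ℝ) + 1) ^ 2 * (T L : ℝ) ≤ 3 * A * ((L : ℝ) + 1) ^ (k + 2) := by
    calc 3 * ((L : ℝ) + 1) ^ 2 * (T L : ℝ) ≤ 3 * ((L : ℝ) + 1) ^ 2 * (A * ((L : ℝ) + 1) ^ k) := by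
          gcongr
      _ = 3 * A * ((L : ℝ) + 1) ^ (k + 2) := by ring
  calc 3 * ((L : ℝ) + 1) ^ 2 * (T L : ℝ) * (r ^ L * r)
      ≤ 3 * A * ((L : ℝ) + 1) ^ (k + 2) * (r ^ L * r) :=
        mul_le_mul_of_nonneg_right hnum (by positivity)
    _ = 3 * A * r * ((L : ℝ) + 1) ^ (k + 2) * r ^ L := by ring

/-- The canonical instance: `T(L) = L + 1` rounds, canonical minimum-weight space-time decoders —
exponential decay at every `0 ≤ p < 1/(4·10⁴)`, unconditional. [cite: DennisEtAl2002, §5.3 (after eq. (fail_iso))] -/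
theorem decaysExponentially_stMinWeight_cluster {p : ℝ} (hp₀ : 0 ≤ p)
    (hpp : p < 1 / (4 * (10 : ℝ) ^ 4)) :
    DecaysExponentially
      (phenomFailureFamily (fun L => L + 1)
        fun L => Decoder.minWeight (stSyn (L + 1) (L + 1)) hammingNorm) p :=
  phenom_decaysExponentially_cluster isPolyBounded_succ
    (fun L => ToricCode.isMinWeight_stMinWeight (L + 1) (L + 1)) hp₀ hpp

/-- **Exponential decay below `p₀(ν)`, DKLP route, CONDITIONAL** on the finite-size named fact
`ToricCode.phenomFailureProb_le_of_sawCountBound`: under `cₙ(ℤ³) ≤ C νⁿ` (`ν ≥ 1`), for every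
polynomially bounded schedule and every minimum-weight space-time decoder family, the failure
probability decays exponentially in `L` at every `0 ≤ p < p₀(ν)` (bound
`2(L+1)²(T(L)+1) C r^{L+1}/(ν(1-r))` from size `L + 1 ≥ 3` on, `r = 2ν√(p(1-p))`).
[cite: DennisEtAl2002, §5.3 eq. (fail_iso) and the sentence after it] -/
theorem phenom_decaysExponentially_sawCountBound3 (h₂ : phenomFailureProb_le_of_sawCountBound)
    {C ν : ℝ} (hν : 1 ≤ ν) (hc : SAWCountBound3 C ν) {T : ℕ → ℕ} (hT : IsPolyBounded T)
    {D : (L : ℕ) → STDecoder (L + 1) (T L)}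
    (hD : ∀ L, (D L).IsMinWeight (stSyn (L + 1) (T L)) (stCycles (L + 1) (T L)) hammingNorm)
    {p : ℝ} (hp₀ : 0 ≤ p) (hpp : p < thresholdValue ν) :
    DecaysExponentially (phenomFailureFamily T D) p := by
  -- `p < p₀(ν)` ⟹ `r = 2ν√(p(1-p)) < 1`
  have hp : p ≤ 1 / 2 := hpp.le.trans (thresholdValue_le_half ν)
  have hlt : p * (1 - p) < thresholdValue ν * (1 - thresholdValue ν) :=
    mul_one_sub_lt_mul_one_sub hpp (by linarith [thresholdValue_le_half ν])
  have hν0 : 0 < ν := lt_of_lt_of_le one_pos hν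
  have h4 : 4 * ν ^ 2 * (p * (1 - p)) < 1 := by
    calc 4 * ν ^ 2 * (p * (1 - p)) < 4 * ν ^ 2 * (thresholdValue ν * (1 - thresholdValue ν)) := by
          gcongr
      _ = 1 := four_mul_sq_mul_thresholdValue hν
  set s := Real.sqrt (p * (1 - p)) with hs
  set r := 2 * ν * s with hr
  have hpp' : 0 ≤ p * (1 - p) := mul_nonneg hp₀ (by linarith)
  have hr0 : 0 ≤ r := by rw [hr]; positivity
  have hr1 : r < 1 := by
    have hsq : r ^ 2 = 4 * ν ^ 2 * (p * (1 - p)) := by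
      rw [hr, mul_pow, mul_pow, hs, Real.sq_sqrt hpp']; ring
    have h' : r ^ 2 < 1 := by rw [hsq]; exact h4
    have := (sq_lt_one_iff_abs_lt_one r).1 h'
    rwa [abs_of_nonneg hr0] at this
  have h1r : 0 < 1 - r := by linarith
  have hC0 : 0 ≤ C := by
    have h0 := hc 0
    rw [SAW.Zd.count_zero, pow_zero, mul_one, Nat.cast_one] at h0
    linarith
  obtain ⟨A, k, hA⟩ := hT
  have hA0 : 0 ≤ A := by
    have := hA 0
    simp only [Nat.cast_zero, zero_add, one_pow, mul_one] at this
    exact (Nat.cast_nonneg _).trans this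
  refine decaysExponentially_of_eventually_abs_le
    (A := 2 * (A + 1) * C * r / (ν * (1 - r))) (k := k + 2) hr0 hr1 ?_
  rw [eventually_atTop]
  refine ⟨2, fun L hL => ?_⟩
  have hp1 : p ≤ 1 := by linarith
  have hnonneg : 0 ≤ phenomFailureFamily T D L p := by
    simp only [phenomFailureFamily, phenomFailureProb]
    exact Finset.sum_nonneg fun E _ => by
      rw [phenomenologicalWeight_self]
      exact bernoulliWeight_nonneg hp₀ hp1 _
  rw [abs_of_nonneg hnonneg]
  have hb := h₂ C ν hν0 hc (L + 1) (T L) (by omega) (D L) (hD L) p hp₀ hp hr1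
  simp only [phenomFailureFamily]
  refine hb.trans ?_
  push_cast
  have hden : 0 < ν * (1 - r) := by positivity
  rw [div_mul_eq_mul_div, div_mul_eq_mul_div, div_le_div_iff_of_pos_right hden, pow_succ]
  -- `(T L + 1) ≤ (A + 1)(L+1)^k` and `(L+1)² (L+1)^k = (L+1)^{k+2}`
  have hk1 : (1 : ℝ) ≤ ((L : ℝ) + 1) ^ k := one_le_pow₀ (by linarith [(Nat.cast_nonneg L : (0 : ℝ) ≤ L)])
  have hT1 : (T L : ℝ) + 1 ≤ (A + 1) * ((L : ℝ) + 1) ^ k := by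
    calc (T L : ℝ) + 1 ≤ A * ((L : ℝ) + 1) ^ k + 1 * ((L : ℝ) + 1) ^ k := by
          have := hA L; nlinarith
      _ = (A + 1) * ((L : ℝ) + 1) ^ k := by ring
  have hnum : 2 * ((L : ℝ) + 1) ^ 2 * ((T L : ℝ) + 1) * C ≤
      2 * (A + 1) * C * ((L : ℝ) + 1) ^ (k + 2) := by
    calc 2 * ((L : ℝ) + 1) ^ 2 * ((T L : ℝ) + 1) * C
        ≤ 2 * ((L : ℝ) + 1) ^ 2 * ((A + 1) * ((L : ℝ) + 1) ^ k) * C := by gcongr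
      _ = 2 * (A + 1) * C * ((L : ℝ) + 1) ^ (k + 2) := by ring
  calc 2 * ((L : ℝ) + 1) ^ 2 * ((T L : ℝ) + 1) * C * (r ^ L * r)
      ≤ 2 * (A + 1) * C * ((L : ℝ) + 1) ^ (k + 2) * (r ^ L * r) :=
        mul_le_mul_of_nonneg_right hnum (by positivity)
    _ = 2 * (A + 1) * C * r * ((L : ℝ) + 1) ^ (k + 2) * r ^ L := by ring

end PhenomCluster

end Summit.Ventures.QEC.Thresholds

end
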